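import Literature.AlgebraicGeometry.HodgeTheory.FermatEigenspaceHodgeDecomposition
import Literature.AlgebraicGeometry.HodgeTheory.AbelianVarietyEndomorphismsHOne
import Literature.AlgebraicGeometry.HodgeTheory.FermatClaimShiodaSpine
import HarnessLib

/-!
# Aoki's claim is invariant under complex conjugation of the character: `claim(α) ↔ claim(−α)`

Family `hodge`, layer `Literature/AlgebraicGeometry/HodgeTheory`. PROOF FILE (everything PROVED; no
named fact, no definition introduced) for the bookkeeping fact used throughout Shioda's programme
(Shioda, Math. Ann. 245 (1979) §1 (1.7): "`\overline{V(α)} = V(−α)`"; Ran, Compositio Math. 42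
(1980) §1 Prop. 1.7 (iii)): the eigenline `V(α) ⊆ H²ʳ(X²ʳₘ(ℂ); ℂ)` consists of algebraic classes
iff `V(−α)` does, because complex conjugation on `H²ʳ(X(ℂ); ℂ) = H²ʳ(X(ℂ); ℚ) ⊗ ℂ` carries
`V(α)` into `V(−α)` (the tree's `conjClass_mem_fermatEigenspace`) and preserves the `ℂ`-span of the
(rational) algebraic classes (the tree's `conjClass_mem_algebraicClasses`).

* `FermatCharacter.Claim.neg`, `FermatCharacter.claim_neg_iff` — `claim(α) → claim(−α)`, iff form.
* `FermatCharacter.ClaimMultiset.map_neg`, `FermatCharacter.claimMultiset_map_neg_iff` — the same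
  for Shioda's `𝔠ₘ` as a predicate on multisets of residues (`ClaimMultiset m s ↔ ClaimMultiset m (−s)`),
  the form consumed by the lattice criterion of the crux line `cancel-by-any-claim-lattice`
  (`Summits/HodgeConjecture/…/PadicSemiregularLiftHodgeFermatVarietiesLatticeCriterion`), whose
  negation-closed families `D ∋ u, −u` can now be fed one claim per unit orbit representative pair.

## References

* [Shioda1979HodgeFermat] T. Shioda, The Hodge conjecture for Fermat varieties, Math. Ann. 245
  (1979) 175–184, §1 (1.7).
* [Ran1980] Z. Ran, Cycles on Fermat hypersurfaces, Compositio Math. 42 (1980) 121–142, §1 Prop. 1.7 (iii).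
-/

noncomputable section

open Finset

namespace Literature.AlgebraicGeometry.HodgeTheory

open Literature.AlgebraicGeometry.Motives Literature.AlgebraicTopology.SingularHomology

namespace FermatCharacter

variable {m : ℕ}

/-- **`claim(α) ⟹ claim(−α)`** (`α` a character of `X²ʳₘ`): for `x ∈ V(−α)`, `conj x ∈ V(α)` is
algebraic, and the algebraic classes of the smooth projective `X²ʳₘ` are stable under `conj`, so
`x = conj (conj x)` is algebraic. (`r = 0`: every class on `X⁰ₘ` is algebraic.)
[cite: Shioda1979HodgeFermat, §1 (1.7)] [cite: Ran1980, §1 Prop. 1.7 (iii)] -/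
theorem Claim.neg [NeZero m] {r : ℕ} {α : Fin (2 * r + 2) → ZMod m} (h : Claim m r α) :
    Claim m r (-α) := by
  rcases Nat.eq_zero_or_pos r with rfl | hr
  · exact claim_zero m (-α)
  intro x hx
  have hx' : conjClass (ComplexPoints (fermatHypersurface (2 * r) m)) (2 * r) x ∈
      fermatEigenspace m α (2 * r) := by
    simpa only [neg_neg] using conjClass_mem_fermatEigenspace hx
  have halg := conjClass_mem_algebraicClasses
    (isSmoothProjective_fermatHypersurface (n := 2 * r) (m := m) (by omega) (NeZero.one_le)) (h hx')
  rwa [conjClass_conjClass] at halg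

/-- **`claim(−α) ↔ claim(α)`.** [cite: Shioda1979HodgeFermat, §1 (1.7)] -/
theorem claim_neg_iff [NeZero m] {r : ℕ} (α : Fin (2 * r + 2) → ZMod m) :
    Claim m r (-α) ↔ Claim m r α :=
  ⟨fun h ↦ by simpa only [neg_neg] using h.neg, Claim.neg⟩

/-- **`s ∈ 𝔠ₘ ⟹ −s ∈ 𝔠ₘ`** for Shioda's claim predicate on multisets of residues: a character with
multiset of values `−s` is `−α` for a character `α` with multiset `s`. [cite: Shioda1979HodgeFermat, §1 (1.7)] -/
theorem ClaimMultiset.map_neg [NeZero m] {s : Multiset (ZMod m)} (h : ClaimMultiset m s) :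
    ClaimMultiset m (s.map fun a ↦ -a) := by
  intro r α hα
  have h0 : univ.val.map (-α) = s := by
    have := congrArg (Multiset.map fun a : ZMod m ↦ -a) hα
    simpa only [Multiset.map_map, Function.comp_def, neg_neg, Multiset.map_id', Pi.neg_apply] using this
  simpa only [neg_neg] using (h r (-α) h0).neg

/-- **`−s ∈ 𝔠ₘ ↔ s ∈ 𝔠ₘ`.** [cite: Shioda1979HodgeFermat, §1 (1.7)] -/
theorem claimMultiset_map_neg_iff [NeZero m] (s : Multiset (ZMod m)) :
    ClaimMultiset m (s.map fun a ↦ -a) ↔ ClaimMultiset m s := by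
  refine ⟨fun h ↦ ?_, ClaimMultiset.map_neg⟩
  simpa only [Multiset.map_map, Function.comp_def, neg_neg, Multiset.map_id'] using h.map_neg

end FermatCharacter

end Literature.AlgebraicGeometry.HodgeTheory

end
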